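/-
Copyright (c) 2026 the pub-hodgecm-mathlib formalisation cell (harness21).  Prover seat hodgecm-mathlib-LH7-p05 (g0), req620 Track A «(D-RAM) FOUR-FRAME» squad, helper lane on
h413 = stmt-HodgeConjecture-24833 (count-neutral).  β-BOARD v1 row R7 «GLUE CLASSES» — Theorem C bricks, FILE ASM-1 «THE WINDOW CUT IN `g`-CURRENCY».  2026-09-04.
-/
import Summits.HodgeConjecture.HodgeConjecture.Theorems.F0P3cDyRamDiagonalKappaGluedDecomposition   -- ★ κG-C1 (LH4-p09 (g3)): `mapGL_latt_glued_rep_iff` (T-stability of `latt V(1,1,g)` in `g`)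
import Summits.HodgeConjecture.HodgeConjecture.Theorems.F0P3cDyRamLabelledOddPureStrataG1           -- ★ p860827 (LH4-p11 (g8)): DEFS of record (`mcOfRecord`), ★ G1 reads `latticeInLevel_diagonal_latt_G1_iff`
import HarnessLib

/-!
# Crux `H413`, line LH4 «(D-RAM) FOUR-FRAME» — (β) Stage B, β-BOARD row R7, Theorem C («foot window») bricks, FILE ASM-1:
# ON THE FOOT WINDOW THE CLEAN-SHELL CUT OF THE GLUED CLASS REPRESENTATIVE `latt V(1,1,g)` IS THE `g`-SHELL `|g + c₀| = |ϖ|^{2t′+E}`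

Cell `hodgecm-mathlib` (D-0151), FLOOR 0, crux item H413 = `stmt-HodgeConjecture-24833`, route `HCCMUnconditional`; squad F0∕P3c∕LH4 (β-table fan, sub-dealer LH4-p05 (g8)).
THEOREMS ONLY (no `def`, no instance, no notation, no `sorry`, default heartbeats); ★-only imports; lane `--supports stmt-HodgeConjecture-24833 --as helper` (count-neutral);
pays NO row, states NO law.  Consumer: this seat's Theorem C `finsum_stratum_G1_shell_labelledOdd_div_relIndex_eq_zero_of_foot_window` (ROADMAP-R7-TheoremC v1 §3, ASM-2),
between ★ p861389 `finsum_labelledOdd_div_relIndex_glued_sep_eq` (whose right-hand side is a sum over `R.filter (T-stable ∧ shell)`) and LH7-p07 (g0)'s ★ p861522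
`sum_sum_glueShell_eq_sum_image` (which wants the filter `|g + c₀| = |ϖ|^e`).

THE MATHEMATICS.  Letters of record: `T = diag(α, β, 1)`, `|α − 1| = |ϖ|^{n₂}`, ON THE FOOT `|β − 1| = |ϖ|^{n₂ + 2t′}` (so `|β − α| = |ϖ|^{n₂}`), `ℓ₀ = d % 2`, `mc = mcOfRecord d`,
the glued class representative `V(1,1,g) = (1 0 0; 1 ϖ^ρ 0; 1+g ϖ^ρ ϖ^{2ρ+2t′})` with `|g| = |ϖ|^{2t′}`, and the WINDOW `n₂ ≤ 2ρ + ℓ₀ =: n₂ + E`, `2ρ + mc ≤ 2n₂`.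
* §1 `v_eq_pow_iff_le_and_not_le` (discreteness), `v_add_eq_pow_iff_of_v_sub_le` (moving the centre of a shell inside it), `v_div_sub_div_le` (two tokens with a common reference
  class give nearby ratios), `isNormalisedLattice_latt_glued_rep`.
* §2 `stable_and_shell_latt_glued_rep_iff`: by ★ `mapGL_latt_glued_rep_iff` (stability `⟺ |g + g₀| ≤ |ϖ|^{2ρ+2t′−n₂}`, `g₀ = (β−1)∕(α−1)`) and the ★ G1 read at `x = ζ = 1, y″ = g`
  (level `ℓ` of `X = diag(α−1, β−1, 0)` `⟺ ℓ + ρ ≤ n₂ ∧ |g + g₀| ≤ |ϖ|^{ℓ+2ρ+2t′−n₂}`; level `mc` of `X²` automatic from `2ρ + mc ≤ 2n₂`, the mixed term having the two distinct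
  valuations `2n₂ + 4t′`, `2n₂ + 2t′`), `T-stable ∧ (level ℓ₀ ∧ ¬ level ℓ₀+1 ∧ X²-level mc) ⟺ |g + g₀| = |ϖ|^{2t′+E}` (`ρ + ℓ₀ + 1 ≤ n₂` from `mc ≥ 2ℓ₀ + 2`); and
  `stable_and_shell_latt_glued_rep_iff_of_near`: the same with any centre `c₀`, `|c₀ − g₀| ≤ |ϖ|^{2t′+E+1}` (the token ratio `g_β∕g_α` of ASM-2).
HONEST LABEL: count-neutral; Theorem C ∕ hRest ∕ (β-BAL) ∕ (β) ∕ T₊ OPEN; `HC_CM` is proved only modulo the 7 printed citations (2 remaining named inputs: hLiu418 =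
`stmt-HodgeConjecture-24832`, h413 = `stmt-HodgeConjecture-24833`) until rung 0 closes.
References: [Kottwitz1986BaseChangeUnits] §1 pp. 240–241 · [Rogawski1990] §4.9 Prop. 4.9.1 (a)(b) p. 55 · [Serre1980Trees] Ch. II §1.1 · [Serre1979] Ch. II §1, Ch. IV §2.
-/

set_option autoImplicit false

noncomputable section

namespace Summit.HodgeConjecture.HodgeConjecture.Cruxes.H413.F0P3cDyRamLabelledOddGlueWindowCut

open Matrix WithZero
open Literature.NumberTheory.Automorphic Literature.NumberTheory.Automorphic.HermitianLattice
open Literature.NumberTheory.Automorphic.UnitaryLatticeTree Literature.NumberTheory.Automorphic.UnitaryThreeFourFrame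
open Literature.NumberTheory.LocalFields Literature.NumberTheory.LocalFields.WildQuadraticDatum
open Summit.HodgeConjecture.HodgeConjecture.Cruxes.H413.F0P3cDyRamFourFramePieces
open Summit.HodgeConjecture.HodgeConjecture.Cruxes.H413.F0P3cDyRamFourFrameCensusDefs
open Summit.HodgeConjecture.HodgeConjecture.Cruxes.H413.F0P3cDyRamStageOneBDefs (mcOfRecord)
open Summit.HodgeConjecture.HodgeConjecture.Cruxes.H413.F0P3cDyRamDiagonalTorusDefs
open Summit.HodgeConjecture.HodgeConjecture.Cruxes.H413.F0P3cDyRamDiagonalStrataDefs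
open Summit.HodgeConjecture.HodgeConjecture.Cruxes.H413.F0P3cDyRamDiagonalKappaGluedDecomposition (mapGL_latt_glued_rep_iff)
open Summit.HodgeConjecture.HodgeConjecture.Cruxes.H413.F0P3cDyRamLabelledGluedStratumRead (latticeInLevel_diagonal_latt_G1_iff)
open scoped Valued WithZero Matrix MatrixGroups

variable {K : Type} [Field K] [Valued K ℤᵐ⁰]

/-! ## §1  Valuation book-keeping -/

/-- **DISCRETENESS IN `ϖ`-CURRENCY**: `|x| = |ϖ|^k ⟺ |x| ≤ |ϖ|^k ∧ ¬ |x| ≤ |ϖ|^{k+1}` (`|ϖ| = exp(−1)`; the value group is `ℤ`). [cite: Serre1979, Ch. II §1] -/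
theorem v_eq_pow_iff_le_and_not_le {ϖ : K} (hϖ : Valued.v ϖ = exp (-1 : ℤ)) (x : K) (k : ℕ) :
    Valued.v x = Valued.v ϖ ^ k ↔ Valued.v x ≤ Valued.v ϖ ^ k ∧ ¬ Valued.v x ≤ Valued.v ϖ ^ (k + 1) := by
  rw [v_varpi_pow hϖ, v_varpi_pow hϖ]
  constructor
  · intro h
    refine ⟨h.le, fun h' => ?_⟩
    rw [h, exp_le_exp] at h'
    push_cast at h'
    omega
  · rintro ⟨h1, h2⟩
    rw [not_le] at h2
    rcases eq_or_ne (Valued.v x) 0 with h0 | h0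
    · rw [h0] at h2; exact absurd h2 (not_lt.2 zero_le)
    · obtain ⟨m, hm⟩ : ∃ m : ℤ, Valued.v x = exp m := ⟨_, (exp_log h0).symm⟩
      rw [hm, exp_le_exp] at h1
      rw [hm, exp_lt_exp] at h2
      rw [hm, exp_inj]
      push_cast at h2
      omega

/-- **MOVING THE CENTRE OF A SHELL INSIDE IT**: if `|c₀ − g₀| ≤ |ϖ|^{k+1}` then `|g + g₀| = |ϖ|^k ⟺ |g + c₀| = |ϖ|^k`. [cite: Serre1979, Ch. II §1] -/
theorem v_add_eq_pow_iff_of_v_sub_le {ϖ : K} (hϖ : Valued.v ϖ = exp (-1 : ℤ)) {c₀ g₀ : K} {k : ℕ} (hc : Valued.v (c₀ - g₀) ≤ Valued.v ϖ ^ (k + 1)) (g : K) :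
    Valued.v (g + g₀) = Valued.v ϖ ^ k ↔ Valued.v (g + c₀) = Valued.v ϖ ^ k := by
  have hlt : Valued.v (c₀ - g₀) < Valued.v ϖ ^ k := by
    refine hc.trans_lt ?_
    rw [v_varpi_pow hϖ, v_varpi_pow hϖ, exp_lt_exp]; push_cast; omega
  constructor
  · intro h
    rw [show g + c₀ = g + g₀ + (c₀ - g₀) by ring, Valuation.map_add_eq_of_lt_left _ (by rwa [h]), h]
  · intro h
    rw [show g + g₀ = g + c₀ - (c₀ - g₀) by ring, Valuation.map_sub_eq_of_lt_left _ (by rwa [h]), h]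

/-- **TWO TOKENS WITH A COMMON REFERENCE CLASS HAVE NEARBY RATIOS**: from `|x − p·c| ≤ |ϖ|^a`, `|y − q·c| ≤ |ϖ|^b`, `|x| = |ϖ|^m`, `|p| = |ϖ|^{mp}`, `|q| = |ϖ|^{mq}` (`x, p ≠ 0`) one gets
`|q∕p − y∕x| ≤ |ϖ|^k` whenever `k + mp + m ≤ mq + a` and `k + m ≤ b` — since `q∕p − y∕x = (q(x − pc) − p(y − qc))∕(px)`. [cite: Serre1979, Ch. II §1] -/
theorem v_div_sub_div_le {ϖ : K} (hϖ : Valued.v ϖ = exp (-1 : ℤ)) {x y p q c : K} {m mp mq a b k : ℕ}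
    (hx : Valued.v x = Valued.v ϖ ^ m) (hp : Valued.v p = Valued.v ϖ ^ mp) (hq : Valued.v q = Valued.v ϖ ^ mq)
    (hxa : Valued.v (x - p * c) ≤ Valued.v ϖ ^ a) (hyb : Valued.v (y - q * c) ≤ Valued.v ϖ ^ b)
    (hk1 : k + mp + m ≤ mq + a) (hk2 : k + m ≤ b) :
    Valued.v (q / p - y / x) ≤ Valued.v ϖ ^ k := by
  have hϖ0 : ϖ ≠ 0 := fun h0 => by rw [h0, map_zero] at hϖ; exact WithZero.coe_ne_zero hϖ.symm
  have hvϖ : Valued.v ϖ ≠ 0 := (Valuation.ne_zero_iff _).2 hϖ0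
  have hx0 : x ≠ 0 := fun h => by rw [h, map_zero] at hx; exact pow_ne_zero _ hvϖ hx.symm
  have hp0 : p ≠ 0 := fun h => by rw [h, map_zero] at hp; exact pow_ne_zero _ hvϖ hp.symm
  have hpw : ∀ u v : ℕ, Valued.v ϖ ^ u ≤ Valued.v ϖ ^ v ↔ v ≤ u := fun u v => by
    rw [v_varpi_pow hϖ, v_varpi_pow hϖ, exp_le_exp]; omega
  have heq : q / p - y / x = (q * (x - p * c) - p * (y - q * c)) / (p * x) := by field_simp; ring
  rw [heq, map_div₀, map_mul, hp, hx, div_le_iff₀ (by rw [← map_pow, ← map_pow, ← map_mul]; exact (Valuation.pos_iff _).2 (mul_ne_zero (pow_ne_zero _ hϖ0) (pow_ne_zero _ hϖ0))),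
    ← pow_add, ← pow_add]
  refine (Valuation.map_sub _ _ _).trans (max_le ?_ ?_)
  · rw [map_mul, hq]
    calc Valued.v ϖ ^ mq * Valued.v (x - p * c) ≤ Valued.v ϖ ^ mq * Valued.v ϖ ^ a := by gcongr
      _ = Valued.v ϖ ^ (mq + a) := (pow_add _ _ _).symm
      _ ≤ Valued.v ϖ ^ (k + (mp + m)) := (hpw _ _).2 (by omega)
  · rw [map_mul, hp]
    calc Valued.v ϖ ^ mp * Valued.v (y - q * c) ≤ Valued.v ϖ ^ mp * Valued.v ϖ ^ b := by gcongr
      _ = Valued.v ϖ ^ (mp + b) := (pow_add _ _ _).symm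
      _ ≤ Valued.v ϖ ^ (k + (mp + m)) := (hpw _ _).2 (by omega)

/-- **THE GLUED CLASS REPRESENTATIVE IS NORMALISED**: `latt (1 0 0; 1 ϖ^ρ 0; 1+g ϖ^ρ ϖ^{2ρ+2t′})` with `|g| < 1` has every coordinate ideal `= 𝒪` (rows contain the units `1`, `1`,
`1 + g`; all entries integral — ★ p855280 `normalised_latt_hnf_iff`). [cite: Serre1980Trees, Ch. II §1.1] -/
theorem isNormalisedLattice_latt_glued_rep {ϖ : K} (hϖ1 : Valued.v ϖ ≤ 1) (ρ t' : ℕ) {g : K} (hg : Valued.v g < 1) :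
    IsNormalisedLattice (latt (!![1, 0, 0; 1, ϖ ^ ρ, 0; 1 * 1 + g, ϖ ^ ρ * 1, ϖ ^ (2 * ρ + 2 * t')] : Matrix (Fin 3) (Fin 3) K)) := by
  have hp : Valued.v (ϖ ^ ρ) ≤ 1 := by rw [map_pow]; exact pow_le_one₀ zero_le hϖ1
  have hr : Valued.v (ϖ ^ (2 * ρ + 2 * t')) ≤ 1 := by rw [map_pow]; exact pow_le_one₀ zero_le hϖ1
  have hz : Valued.v (ϖ ^ ρ * 1) ≤ 1 := by rw [mul_one]; exact hp
  have hy : Valued.v (1 * 1 + g) = 1 := by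
    rw [one_mul, Valuation.map_add_eq_of_lt_left _ (by rwa [map_one]), map_one]
  have hform : (!![1, 0, 0; 1, ϖ ^ ρ, 0; 1 * 1 + g, ϖ ^ ρ * 1, ϖ ^ (2 * ρ + 2 * t')] : Matrix (Fin 3) (Fin 3) K) =
      Matrix.of ![![1, 0, 0], ![1, ϖ ^ ρ, 0], ![1 * 1 + g, ϖ ^ ρ * 1, ϖ ^ (2 * ρ + 2 * t')]] := rfl
  rw [hform]
  exact (F0P3cDyRamDiagonalStableLatticeHNF.normalised_latt_hnf_iff (x := 1) (by rw [map_one]) hy.le hz hp hr).2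
    ⟨Or.inr (map_one _), Or.inr (Or.inl hy)⟩

/-! ## §2  The cut in `g`-currency -/

variable {σ : K →+* K} {ϖ : K} {d t : ℕ} {α β : K} {N₀ n₁ n₂ n₃ : ℕ}

/-- **THE WINDOW CUT OF THE GLUED CLASS REPRESENTATIVE, CENTRE `g₀ = (β−1)∕(α−1)`**: on the foot `n₁ = n₂ + 2t′`, in the window `n₂ ≤ 2ρ + ℓ₀ = n₂ + E`, `2ρ + mc ≤ 2n₂`, for
`|g| = |ϖ|^{2t′}` the class representative `latt V(1,1,g)` is `T`-stable AND on the clean shell (`X`-level exactly `ℓ₀`, `X²`-level `mc`) iff `|g + (β−1)∕(α−1)| = |ϖ|^{2t′+E}`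
(★ `mapGL_latt_glued_rep_iff` + the ★ G1 read at `x = ζ = 1`, `y″ = g`; the `X²`-token is automatic in the window). [cite: Kottwitz1986BaseChangeUnits, §1 pp. 240–241]
[cite: Serre1980Trees, Ch. II §1.1] -/
theorem stable_and_shell_latt_glued_rep_iff (hD : IsRamifiedQuadraticDatum σ ϖ d t) (h2d : 2 ≤ d) (hE : IsElementDatum σ ϖ N₀ α β n₁ n₂ n₃)
    (T : GL (Fin 3) K) (hT : (T : Matrix (Fin 3) (Fin 3) K) = Matrix.diagonal ![α, β, 1])
    (ρ t' : ℕ) (ht' : 1 ≤ t') (hfoot : n₁ = n₂ + 2 * t') {E : ℕ} (hlo : 2 * ρ + d % 2 = n₂ + E) (hhi : 2 * ρ + mcOfRecord d ≤ 2 * n₂)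
    {g : K} (hg : Valued.v g = Valued.v ϖ ^ (2 * t')) (V : GL (Fin 3) K)
    (hV : (V : Matrix (Fin 3) (Fin 3) K) = !![1, 0, 0; 1, ϖ ^ ρ, 0; 1 * 1 + g, ϖ ^ ρ * 1, ϖ ^ (2 * ρ + 2 * t')]) :
    (mapGL T (latt (V : Matrix (Fin 3) (Fin 3) K)) = latt (V : Matrix (Fin 3) (Fin 3) K) ∧
        (LatticeInLevel ϖ (d % 2) (Matrix.diagonal ![α - 1, β - 1, 0]) (latt (V : Matrix (Fin 3) (Fin 3) K)) ∧
          ¬ LatticeInLevel ϖ (d % 2 + 1) (Matrix.diagonal ![α - 1, β - 1, 0]) (latt (V : Matrix (Fin 3) (Fin 3) K)) ∧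
          LatticeInLevel ϖ (mcOfRecord d) (Matrix.diagonal ![(α - 1) * (α - 1), (β - 1) * (β - 1), 0]) (latt (V : Matrix (Fin 3) (Fin 3) K)))) ↔
      Valued.v (g + (β - 1) / (α - 1)) = Valued.v ϖ ^ (2 * t' + E) := by
  classical
  have hD' := hD
  obtain ⟨hσ, hvσ, hϖ, -, -, -, -⟩ := hD'
  have hϖ0 : ϖ ≠ 0 := fun h0 => by rw [h0, map_zero] at hϖ; exact WithZero.coe_ne_zero hϖ.symm
  have hvϖ : Valued.v ϖ ≠ 0 := (Valuation.ne_zero_iff _).2 hϖ0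
  have hpw : ∀ a b : ℕ, Valued.v ϖ ^ a ≤ Valued.v ϖ ^ b ↔ b ≤ a := fun a b => by
    rw [v_varpi_pow hϖ, v_varpi_pow hϖ, exp_le_exp]; omega
  have hpwlt : ∀ a b : ℕ, Valued.v ϖ ^ a < Valued.v ϖ ^ b ↔ b < a := fun a b => by
    rw [v_varpi_pow hϖ, v_varpi_pow hϖ, exp_lt_exp]; omega
  have hmc : 2 * (d % 2) + 2 ≤ mcOfRecord d := by
    simp only [mcOfRecord, F0P3cDyRamFourFramePieces.mstarOfRecord]; omega
  have hα : Valued.v (α - 1) = Valued.v ϖ ^ n₂ := hE.2.2.2.2.2.2.1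
  have hβ : Valued.v (β - 1) = Valued.v ϖ ^ (n₂ + 2 * t') := by have h := hE.2.2.2.2.2.1; rwa [hfoot] at h
  -- units
  have hunit : ∀ {z : K}, z * σ z = 1 → Valued.v z = 1 := by
    intro z hz
    have h2 : Valued.v z ^ 2 = 1 := by
      have := congrArg Valued.v hz
      rwa [map_mul, hvσ, map_one, ← sq] at this
    exact (pow_eq_one_iff.1 h2).resolve_right (by norm_num)
  have hα1 : Valued.v α = 1 := hunit hE.1
  have hβ1 : Valued.v β = 1 := hunit hE.2.1
  have hα0 : α - 1 ≠ 0 := fun h => by rw [h, map_zero] at hα; exact pow_ne_zero _ hvϖ hα.symm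
  have hγ : Valued.v (β - α) = Valued.v ϖ ^ n₂ := by
    rw [show β - α = β - 1 - (α - 1) by ring, Valuation.map_sub_eq_of_lt_right _ (by rw [hα, hβ, hpwlt]; omega), hα]
  -- the mixed terms of the two reads, in `g₀`-currency
  set g₀ : K := (β - 1) / (α - 1) with hg₀
  have hmix : ∀ ℓ : ℕ, Valued.v (1 * 1 * (0 - (β - 1)) + (0 - (α - 1)) * g) ≤ Valued.v ϖ ^ (ℓ + 2 * ρ + 2 * t') ↔
      Valued.v (g + g₀) ≤ Valued.v ϖ ^ (ℓ + 2 * ρ + 2 * t' - n₂) := by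
    intro ℓ
    have hℓ : n₂ ≤ ℓ + 2 * ρ + 2 * t' := by omega
    rw [show 1 * 1 * (0 - (β - 1)) + (0 - (α - 1)) * g = -((g + g₀) * (α - 1)) by rw [hg₀]; field_simp; ring, Valuation.map_neg,
      show Valued.v ϖ ^ (ℓ + 2 * ρ + 2 * t') = Valued.v (ϖ ^ (ℓ + 2 * ρ + 2 * t' - n₂) * (α - 1)) by
        rw [map_mul, map_pow, hα, ← pow_add]; congr 1; omega,
      F0P3cDyRamLevelTokenHNF.v_mul_le_mul_iff_of_ne_zero hα0, map_pow]
  have hsq : Valued.v (1 * 1 * (0 - (β - 1) * (β - 1)) + (0 - (α - 1) * (α - 1)) * g) = Valued.v ϖ ^ (2 * n₂ + 2 * t') := by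
    have h1 : Valued.v (1 * 1 * (0 - (β - 1) * (β - 1))) = Valued.v ϖ ^ (2 * n₂ + 4 * t') := by
      rw [one_mul, one_mul, zero_sub, Valuation.map_neg, map_mul, hβ, ← pow_add]; congr 1; omega
    have h2 : Valued.v ((0 - (α - 1) * (α - 1)) * g) = Valued.v ϖ ^ (2 * n₂ + 2 * t') := by
      rw [zero_sub, neg_mul, Valuation.map_neg, map_mul, map_mul, hα, hg, ← pow_add, ← pow_add]; congr 1; omega
    rw [Valuation.map_add_eq_of_lt_right _ (by rw [h1, h2, hpwlt]; omega), h2]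
  -- the reads
  have hread : ∀ ℓ : ℕ, LatticeInLevel ϖ ℓ (Matrix.diagonal ![α - 1, β - 1, 0]) (latt (V : Matrix (Fin 3) (Fin 3) K)) ↔
      ℓ + ρ ≤ n₂ ∧ Valued.v (g + g₀) ≤ Valued.v ϖ ^ (ℓ + 2 * ρ + 2 * t' - n₂) := by
    intro ℓ
    rw [hV, latticeInLevel_diagonal_latt_G1_iff hϖ0 ℓ ρ (2 * t') _ (x := 1) (ζ := 1) (by rw [map_one]) (by rw [map_one]) g]
    simp only [Matrix.cons_val_zero, Matrix.cons_val_one, Matrix.cons_val_two, Matrix.tail_cons, Matrix.head_cons]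
    rw [hmix ℓ, map_zero, show β - 1 - (α - 1) = β - α by ring, hγ, zero_sub, Valuation.map_neg, hα, hβ]
    simp only [hpw, zero_le, and_true]
    constructor
    · rintro ⟨-, h2, -, h4⟩; exact ⟨by omega, h4⟩
    · rintro ⟨h1, h4⟩; exact ⟨⟨by omega, by omega⟩, by omega, by omega, h4⟩
  have hread2 : LatticeInLevel ϖ (mcOfRecord d) (Matrix.diagonal ![(α - 1) * (α - 1), (β - 1) * (β - 1), 0]) (latt (V : Matrix (Fin 3) (Fin 3) K)) := by
    rw [hV, latticeInLevel_diagonal_latt_G1_iff hϖ0 (mcOfRecord d) ρ (2 * t') _ (x := 1) (ζ := 1) (by rw [map_one]) (by rw [map_one]) g]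
    have hA2 : Valued.v ((α - 1) * (α - 1)) = Valued.v ϖ ^ (2 * n₂) := by rw [map_mul, hα, ← pow_add, two_mul]
    have hB2 : Valued.v ((β - 1) * (β - 1)) = Valued.v ϖ ^ (2 * n₂ + 4 * t') := by rw [map_mul, hβ, ← pow_add]; congr 1; omega
    have hAB : Valued.v ((β - 1) * (β - 1) - (α - 1) * (α - 1)) = Valued.v ϖ ^ (2 * n₂) := by
      rw [Valuation.map_sub_eq_of_lt_right _ (by rw [hA2, hB2, hpwlt]; omega), hA2]
    simp only [Matrix.cons_val_zero, Matrix.cons_val_one, Matrix.cons_val_two, Matrix.tail_cons, Matrix.head_cons]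
    rw [hsq, map_zero, hAB, zero_sub, Valuation.map_neg, hA2, hB2]
    simp only [hpw, zero_le, and_true]
    exact ⟨⟨by omega, by omega⟩, by omega, by omega, by omega⟩
  -- assemble
  rw [mapGL_latt_glued_rep_iff hϖ hα1 hβ1 T hT hβ hα hγ (ρ := ρ) (by omega) (by omega) g V hV, hread, hread, v_eq_pow_iff_le_and_not_le hϖ]
  rw [show d % 2 + 2 * ρ + 2 * t' - n₂ = 2 * t' + E by omega, show d % 2 + 1 + 2 * ρ + 2 * t' - n₂ = 2 * t' + E + 1 by omega]
  constructor
  · rintro ⟨-, ⟨-, hle⟩, hn, -⟩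
    exact ⟨hle, fun h => hn ⟨by omega, h⟩⟩
  · rintro ⟨hle, hn⟩
    refine ⟨hle.trans ((hpw _ _).2 (by omega)), ⟨by omega, hle⟩, fun h => hn h.2, hread2⟩

/-- **THE WINDOW CUT, ANY NEARBY CENTRE**: with `c₀` such that `|c₀ − (β−1)∕(α−1)| ≤ |ϖ|^{2t′+E+1}` (the token ratio `g_β∕g_α` of ASM-2), `T-stable ∧ clean shell ⟺ |g + c₀| = |ϖ|^{2t′+E}`
for the glued class representative `latt V(1,1,g)`, `|g| = |ϖ|^{2t′}`, on the foot window. [cite: Kottwitz1986BaseChangeUnits, §1 pp. 240–241] [cite: Serre1980Trees, Ch. II §1.1] -/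
theorem stable_and_shell_latt_glued_rep_iff_of_near (hD : IsRamifiedQuadraticDatum σ ϖ d t) (h2d : 2 ≤ d) (hE : IsElementDatum σ ϖ N₀ α β n₁ n₂ n₃)
    (T : GL (Fin 3) K) (hT : (T : Matrix (Fin 3) (Fin 3) K) = Matrix.diagonal ![α, β, 1])
    (ρ t' : ℕ) (ht' : 1 ≤ t') (hfoot : n₁ = n₂ + 2 * t') {E : ℕ} (hlo : 2 * ρ + d % 2 = n₂ + E) (hhi : 2 * ρ + mcOfRecord d ≤ 2 * n₂)
    {c₀ : K} (hc₀ : Valued.v (c₀ - (β - 1) / (α - 1)) ≤ Valued.v ϖ ^ (2 * t' + E + 1))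
    {g : K} (hg : Valued.v g = Valued.v ϖ ^ (2 * t')) (V : GL (Fin 3) K)
    (hV : (V : Matrix (Fin 3) (Fin 3) K) = !![1, 0, 0; 1, ϖ ^ ρ, 0; 1 * 1 + g, ϖ ^ ρ * 1, ϖ ^ (2 * ρ + 2 * t')]) :
    (mapGL T (latt (V : Matrix (Fin 3) (Fin 3) K)) = latt (V : Matrix (Fin 3) (Fin 3) K) ∧
        (LatticeInLevel ϖ (d % 2) (Matrix.diagonal ![α - 1, β - 1, 0]) (latt (V : Matrix (Fin 3) (Fin 3) K)) ∧
          ¬ LatticeInLevel ϖ (d % 2 + 1) (Matrix.diagonal ![α - 1, β - 1, 0]) (latt (V : Matrix (Fin 3) (Fin 3) K)) ∧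
          LatticeInLevel ϖ (mcOfRecord d) (Matrix.diagonal ![(α - 1) * (α - 1), (β - 1) * (β - 1), 0]) (latt (V : Matrix (Fin 3) (Fin 3) K)))) ↔
      Valued.v (g + c₀) = Valued.v ϖ ^ (2 * t' + E) := by
  rw [stable_and_shell_latt_glued_rep_iff hD h2d hE T hT ρ t' ht' hfoot hlo hhi hg V hV, v_add_eq_pow_iff_of_v_sub_le hD.2.2.1 hc₀ g]

end Summit.HodgeConjecture.HodgeConjecture.Cruxes.H413.F0P3cDyRamLabelledOddGlueWindowCut

end
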